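import Summits.QuantumFields.YangMills.Theorems.LuscherReductionTwistedTraceScalingGaussianPi
import Summits.QuantumFields.YangMills.Theorems.LuscherReductionTwistedTraceScalingGaugeActionLinear
import Mathlib.Analysis.SpecialFunctions.Gaussian.GaussianIntegral
import Mathlib.MeasureTheory.Integral.Pi
import HarnessLib

/-!
# The abstract Laplace sandwich in flat product coordinates: a weight squeezed between Gaussians on a core and below half a Gaussian outside has integral
# `I(1+η) − e^{−c²r²/2s²} I(1/2) ≤ ∫ G ≤ I(1−η) + e^{−c²r²/4s²} I(1/4)`, `I(a) = ∫ exp(−a‖Aw‖²/s²) dw`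
# (lane A of S-BASE, crux `TwistedTraceScaling` stmt-QuantumFields-20203, C4 INNER; design note `pub/ym-fleet/ym-luscher-20007-p1/COARSE-DESIGN.md` §23.9 (N2-d))

This is the real-analysis step of the Laplace evaluation (N2) of the Faddeev–Popov weight, once and for all, with NO set integrals: the two-regime hypotheses
(sharp `(1∓η)`-Gaussian bounds on the core `‖w‖∞ ≤ r`, the crude bound `G ≤ exp(−‖Aw‖²/2s²)` off the core, coercivity `c‖w‖∞ ≤ ‖Aw‖`) give POINTWISE envelopes
`exp(−(1+η)Q/s²) − e^{−c²r²/2s²}·exp(−Q/2s²) ≤ G ≤ exp(−(1−η)Q/s²) + e^{−c²r²/4s²}·exp(−Q/4s²)` valid everywhere (★ `laplace_lower_envelope`, ★ `laplace_upper_envelope`),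
whose integrals are Gaussians (`…GaussianPi`: `I(a) = (πs²/a)^{d/2}/normDet`).  ★★ `laplace_sandwich`.  Also: ★ `integrable_exp_neg_quad` — `w ↦ exp(−a‖Aw‖²/s²)` is integrable for
`a > 0` under coercivity (domination by a product Gaussian).
HONEST FRAMING: textbook analysis for a stub of a child of the CONDITIONAL reduction route R2b1; no spectral claim; C4 OPEN; not a gap, not Clay.
-/

set_option autoImplicit false

noncomputable section

open MeasureTheory Real
open scoped BigOperators

namespace Summit.QuantumFields.YangMills.Theorems.FemtoTransferGap.TwoLattice.ConstTube

variable {ι : Type*} [Fintype ι] {F : Type*} [NormedAddCommGroup F] [InnerProductSpace ℝ F]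

/-! ## §1 Integrability of Gaussians of a coercive linear map -/

/-- A product Gaussian with any rate `κ > 0` is integrable on `ι → Fin 3 → ℝ`. [folklore] -/
theorem integrable_prodGaussian {κ : ℝ} (hκ : 0 < κ) : Integrable (fun w : ι → Fin 3 → ℝ => Real.exp (-(κ * ∑ i, ∑ a, w i a ^ 2))) := by
  have h1 : ∀ _i : ι, Integrable (fun v : Fin 3 → ℝ => Real.exp (-(κ * ∑ a, v a ^ 2))) := fun _ => by
    have h2 : ∀ _a : Fin 3, Integrable (fun x : ℝ => Real.exp (-κ * x ^ 2)) := fun _ => integrable_exp_neg_mul_sq hκ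
    have h3 := Integrable.fintype_prod (μ := fun _ : Fin 3 => (volume : Measure ℝ)) h2
    refine (h3.congr (ae_of_all _ fun v => ?_))
    show ∏ a, Real.exp (-κ * v a ^ 2) = Real.exp (-(κ * ∑ a, v a ^ 2))
    rw [← Real.exp_sum, Finset.mul_sum, ← Finset.sum_neg_distrib]
    exact congrArg Real.exp (Finset.sum_congr rfl fun a _ => by ring)
  have h4 := Integrable.fintype_prod (μ := fun _ : ι => (volume : Measure (Fin 3 → ℝ))) h1
  refine h4.congr (ae_of_all _ fun w => ?_)
  show ∏ i, Real.exp (-(κ * ∑ a, w i a ^ 2)) = Real.exp (-(κ * ∑ i, ∑ a, w i a ^ 2))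
  rw [← Real.exp_sum, Finset.mul_sum, ← Finset.sum_neg_distrib]

omit [Fintype ι] in
/-- `Σ_i Σ_a w_{ia}² ≤ 3|ι|·‖w‖∞²`. [folklore] -/
theorem sum_sum_sq_le [Fintype ι] (w : ι → Fin 3 → ℝ) : ∑ i, ∑ a, w i a ^ 2 ≤ 3 * Fintype.card ι * ‖w‖ ^ 2 := by
  calc ∑ i, ∑ a, w i a ^ 2 ≤ ∑ _i : ι, 3 * ‖w‖ ^ 2 := Finset.sum_le_sum fun i _ => by
        have h := sum_sq_le_three_norm_sq (w i)
        have hi : ‖w i‖ ≤ ‖w‖ := norm_le_pi_norm w i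
        nlinarith [norm_nonneg (w i)]
    _ = 3 * Fintype.card ι * ‖w‖ ^ 2 := by rw [Finset.sum_const, Finset.card_univ, nsmul_eq_mul]; ring

/-- ★ Under coercivity `c‖w‖∞ ≤ ‖Aw‖`, `w ↦ exp(−a‖Aw‖²/s²)` is integrable for `a > 0`. [folklore] -/
theorem integrable_exp_neg_quad [Nonempty ι] (A : (ι → Fin 3 → ℝ) →ₗ[ℝ] F) {c s a : ℝ} (hc : 0 < c) (hs : 0 < s) (ha : 0 < a)
    (hcoer : ∀ w, c * ‖w‖ ≤ ‖A w‖) : Integrable (fun w : ι → Fin 3 → ℝ => Real.exp (-(a * ‖A w‖ ^ 2 / s ^ 2))) := by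
  have hn : (0 : ℝ) < Fintype.card ι := by exact_mod_cast Fintype.card_pos
  set κ : ℝ := a * c ^ 2 / (3 * Fintype.card ι * s ^ 2) with hκ
  have hκ0 : 0 < κ := by rw [hκ]; positivity
  have hcont : Continuous fun w : ι → Fin 3 → ℝ => Real.exp (-(a * ‖A w‖ ^ 2 / s ^ 2)) := by
    have hA : Continuous A := A.continuous_of_finiteDimensional
    fun_prop
  refine (integrable_prodGaussian hκ0).mono' hcont.aestronglyMeasurable (ae_of_all _ fun w => ?_)
  rw [Real.norm_eq_abs, abs_of_pos (Real.exp_pos _), Real.exp_le_exp, neg_le_neg_iff]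
  have h1 := sum_sum_sq_le w
  have h2 : c ^ 2 * ‖w‖ ^ 2 ≤ ‖A w‖ ^ 2 := by
    have := hcoer w
    have h0 : 0 ≤ c * ‖w‖ := by positivity
    nlinarith
  calc κ * ∑ i, ∑ a, w i a ^ 2 ≤ κ * (3 * Fintype.card ι * ‖w‖ ^ 2) := mul_le_mul_of_nonneg_left h1 hκ0.le
    _ = a * (c ^ 2 * ‖w‖ ^ 2) / s ^ 2 := by rw [hκ]; field_simp
    _ ≤ a * ‖A w‖ ^ 2 / s ^ 2 := by gcongr

/-! ## §2 The pointwise envelopes -/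

section Envelopes

variable (A : (ι → Fin 3 → ℝ) →ₗ[ℝ] F) {c s r η : ℝ} (hc : 0 < c) (hs : 0 < s) (hr : 0 ≤ r) (hη0 : 0 ≤ η)
  (hcoer : ∀ w, c * ‖w‖ ≤ ‖A w‖) {G : (ι → Fin 3 → ℝ) → ℝ} (hG0 : ∀ w, 0 ≤ G w)
  (hcore : ∀ w, ‖w‖ ≤ r → Real.exp (-((1 + η) * ‖A w‖ ^ 2 / s ^ 2)) ≤ G w ∧ G w ≤ Real.exp (-((1 - η) * ‖A w‖ ^ 2 / s ^ 2)))
  (hoff : ∀ w, r < ‖w‖ → G w ≤ Real.exp (-(‖A w‖ ^ 2 / (2 * s ^ 2))))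

include hc hr hcoer in
/-- Off the core the form is at least `c²r²`. [folklore] -/
theorem quad_ge_of_off {w : ι → Fin 3 → ℝ} (hw : r < ‖w‖) : c ^ 2 * r ^ 2 ≤ ‖A w‖ ^ 2 := by
  have h1 := hcoer w
  have h2 : c * r ≤ c * ‖w‖ := mul_le_mul_of_nonneg_left hw.le hc.le
  have h3 : 0 ≤ c * r := by positivity
  nlinarith

include hc hr hcoer hcore hoff in
/-- ★ **Upper envelope** (everywhere): `G ≤ exp(−(1−η)Q/s²) + e^{−c²r²/4s²}·exp(−Q/4s²)`. [folklore] -/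
theorem laplace_upper_envelope (w : ι → Fin 3 → ℝ) :
    G w ≤ Real.exp (-((1 - η) * ‖A w‖ ^ 2 / s ^ 2)) + Real.exp (-(c ^ 2 * r ^ 2 / (4 * s ^ 2))) * Real.exp (-(1 / 4 * ‖A w‖ ^ 2 / s ^ 2)) := by
  by_cases hw : ‖w‖ ≤ r
  · have h := (hcore w hw).2
    have hpos : 0 ≤ Real.exp (-(c ^ 2 * r ^ 2 / (4 * s ^ 2))) * Real.exp (-(1 / 4 * ‖A w‖ ^ 2 / s ^ 2)) := by positivity
    linarith
  · rw [not_le] at hw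
    have h := hoff w hw
    have hq := quad_ge_of_off A hc hr hcoer hw
    have hsplit : Real.exp (-(‖A w‖ ^ 2 / (2 * s ^ 2))) = Real.exp (-(‖A w‖ ^ 2 / (4 * s ^ 2))) * Real.exp (-(1 / 4 * ‖A w‖ ^ 2 / s ^ 2)) := by
      rw [← Real.exp_add]; congr 1; field_simp; ring
    have hmono : Real.exp (-(‖A w‖ ^ 2 / (4 * s ^ 2))) ≤ Real.exp (-(c ^ 2 * r ^ 2 / (4 * s ^ 2))) := by
      rw [Real.exp_le_exp, neg_le_neg_iff]
      exact div_le_div_of_nonneg_right hq (by positivity)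
    have hpos1 : 0 ≤ Real.exp (-((1 - η) * ‖A w‖ ^ 2 / s ^ 2)) := (Real.exp_pos _).le
    have hpos2 : 0 ≤ Real.exp (-(1 / 4 * ‖A w‖ ^ 2 / s ^ 2)) := (Real.exp_pos _).le
    calc G w ≤ Real.exp (-(‖A w‖ ^ 2 / (2 * s ^ 2))) := h
      _ = Real.exp (-(‖A w‖ ^ 2 / (4 * s ^ 2))) * Real.exp (-(1 / 4 * ‖A w‖ ^ 2 / s ^ 2)) := hsplit
      _ ≤ Real.exp (-(c ^ 2 * r ^ 2 / (4 * s ^ 2))) * Real.exp (-(1 / 4 * ‖A w‖ ^ 2 / s ^ 2)) := mul_le_mul_of_nonneg_right hmono hpos2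
      _ ≤ _ := by linarith

include hc hr hη0 hcoer hG0 hcore in
/-- ★ **Lower envelope** (everywhere): `exp(−(1+η)Q/s²) − e^{−c²r²/2s²}·exp(−Q/2s²) ≤ G`. [folklore] -/
theorem laplace_lower_envelope (w : ι → Fin 3 → ℝ) :
    Real.exp (-((1 + η) * ‖A w‖ ^ 2 / s ^ 2)) - Real.exp (-(c ^ 2 * r ^ 2 / (2 * s ^ 2))) * Real.exp (-(1 / 2 * ‖A w‖ ^ 2 / s ^ 2)) ≤ G w := by
  by_cases hw : ‖w‖ ≤ r
  · have h := (hcore w hw).1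
    have hpos : 0 ≤ Real.exp (-(c ^ 2 * r ^ 2 / (2 * s ^ 2))) * Real.exp (-(1 / 2 * ‖A w‖ ^ 2 / s ^ 2)) := by positivity
    linarith
  · rw [not_le] at hw
    have hq := quad_ge_of_off A hc hr hcoer hw
    have hQ0 : 0 ≤ ‖A w‖ ^ 2 := sq_nonneg _
    -- `exp(−(1+η)Q/s²) ≤ exp(−Q/s²) = exp(−Q/2s²)·exp(−Q/2s²) ≤ e^{−c²r²/2s²} exp(−Q/2s²)`
    have h1 : Real.exp (-((1 + η) * ‖A w‖ ^ 2 / s ^ 2)) ≤ Real.exp (-(‖A w‖ ^ 2 / s ^ 2)) := by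
      rw [Real.exp_le_exp, neg_le_neg_iff]
      have : ‖A w‖ ^ 2 ≤ (1 + η) * ‖A w‖ ^ 2 := by nlinarith
      exact div_le_div_of_nonneg_right this (by positivity)
    have hsplit : Real.exp (-(‖A w‖ ^ 2 / s ^ 2)) = Real.exp (-(‖A w‖ ^ 2 / (2 * s ^ 2))) * Real.exp (-(1 / 2 * ‖A w‖ ^ 2 / s ^ 2)) := by
      rw [← Real.exp_add]; congr 1; field_simp; ring
    have hmono : Real.exp (-(‖A w‖ ^ 2 / (2 * s ^ 2))) ≤ Real.exp (-(c ^ 2 * r ^ 2 / (2 * s ^ 2))) := by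
      rw [Real.exp_le_exp, neg_le_neg_iff]
      exact div_le_div_of_nonneg_right hq (by positivity)
    have hpos2 : 0 ≤ Real.exp (-(1 / 2 * ‖A w‖ ^ 2 / s ^ 2)) := (Real.exp_pos _).le
    have h2 : Real.exp (-((1 + η) * ‖A w‖ ^ 2 / s ^ 2)) ≤ Real.exp (-(c ^ 2 * r ^ 2 / (2 * s ^ 2))) * Real.exp (-(1 / 2 * ‖A w‖ ^ 2 / s ^ 2)) := by
      calc _ ≤ Real.exp (-(‖A w‖ ^ 2 / s ^ 2)) := h1
        _ = _ := hsplit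
        _ ≤ _ := mul_le_mul_of_nonneg_right hmono hpos2
    linarith [hG0 w]

end Envelopes

/-! ## §3 ★★ The sandwich -/

/-- ★★ **THE LAPLACE SANDWICH**: with `I(a) := ∫ exp(−a‖Aw‖²/s²) dw`,
`I(1+η) − e^{−c²r²/2s²}·I(1/2) ≤ ∫ G ≤ I(1−η) + e^{−c²r²/4s²}·I(1/4)`. [folklore] -/
theorem laplace_sandwich [Nonempty ι] (A : (ι → Fin 3 → ℝ) →ₗ[ℝ] F) {c s r η : ℝ} (hc : 0 < c) (hs : 0 < s) (hr : 0 ≤ r) (hη0 : 0 ≤ η) (hη1 : η < 1)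
    (hcoer : ∀ w, c * ‖w‖ ≤ ‖A w‖) {G : (ι → Fin 3 → ℝ) → ℝ} (hGm : Measurable G) (hG0 : ∀ w, 0 ≤ G w)
    (hcore : ∀ w, ‖w‖ ≤ r → Real.exp (-((1 + η) * ‖A w‖ ^ 2 / s ^ 2)) ≤ G w ∧ G w ≤ Real.exp (-((1 - η) * ‖A w‖ ^ 2 / s ^ 2)))
    (hoff : ∀ w, r < ‖w‖ → G w ≤ Real.exp (-(‖A w‖ ^ 2 / (2 * s ^ 2)))) :
    (∫ w, Real.exp (-((1 + η) * ‖A w‖ ^ 2 / s ^ 2))) - Real.exp (-(c ^ 2 * r ^ 2 / (2 * s ^ 2))) * ∫ w, Real.exp (-(1 / 2 * ‖A w‖ ^ 2 / s ^ 2)) ≤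
        ∫ w, G w ∧
      ∫ w, G w ≤ (∫ w, Real.exp (-((1 - η) * ‖A w‖ ^ 2 / s ^ 2))) + Real.exp (-(c ^ 2 * r ^ 2 / (4 * s ^ 2))) * ∫ w, Real.exp (-(1 / 4 * ‖A w‖ ^ 2 / s ^ 2)) := by
  have hI : ∀ a : ℝ, 0 < a → Integrable (fun w : ι → Fin 3 → ℝ => Real.exp (-(a * ‖A w‖ ^ 2 / s ^ 2))) := fun a ha =>
    integrable_exp_neg_quad A hc hs ha hcoer
  have hup := laplace_upper_envelope A hc hr hcoer hcore hoff
  have hlo := laplace_lower_envelope A hc hr hη0 hcoer hG0 hcore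
  have hUint : Integrable (fun w : ι → Fin 3 → ℝ => Real.exp (-((1 - η) * ‖A w‖ ^ 2 / s ^ 2)) +
      Real.exp (-(c ^ 2 * r ^ 2 / (4 * s ^ 2))) * Real.exp (-(1 / 4 * ‖A w‖ ^ 2 / s ^ 2))) :=
    (hI (1 - η) (by linarith)).add ((hI (1 / 4) (by norm_num)).const_mul _)
  have hGint : Integrable G := by
    refine hUint.mono' hGm.aestronglyMeasurable (ae_of_all _ fun w => ?_)
    rw [Real.norm_eq_abs, abs_of_nonneg (hG0 w)]; exact hup w
  constructor
  · have hLint : Integrable (fun w : ι → Fin 3 → ℝ => Real.exp (-((1 + η) * ‖A w‖ ^ 2 / s ^ 2)) -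
        Real.exp (-(c ^ 2 * r ^ 2 / (2 * s ^ 2))) * Real.exp (-(1 / 2 * ‖A w‖ ^ 2 / s ^ 2))) :=
      (hI (1 + η) (by linarith)).sub ((hI (1 / 2) (by norm_num)).const_mul _)
    have h := integral_mono hLint hGint hlo
    rwa [integral_sub (hI (1 + η) (by linarith)) ((hI (1 / 2) (by norm_num)).const_mul _), integral_const_mul] at h
  · have h := integral_mono hGint hUint hup
    rwa [integral_add (hI (1 - η) (by linarith)) ((hI (1 / 4) (by norm_num)).const_mul _), integral_const_mul] at h

end Summit.QuantumFields.YangMills.Theorems.FemtoTransferGap.TwoLattice.ConstTube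

end
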